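import Literature.Geometry.Lorentzian.InverseMeanCurvatureFlowAECalculus
import HarnessLib

/-!
# Inverse mean curvature flow I — proofs: sub- and supersolutions, translations, and (1.18)

Sorry-free continuation of `InverseMeanCurvatureFlowAECalculus.lean`: the first structural
theorems of Huisken–Ilmanen's level-set theory (J. Differential Geom. 59 (2001), §1) for the weak
formulation (1.5) of `InverseMeanCurvatureFlow.lean`, proved in the functional form (no sets of
finite perimeter, no co-area formula). Everything is proved; no definitions, no named facts.

* `integral_le_of_integral_le_of_sub_le_sub`, `imcfEnergy_le_of_ae_sub_le_sub` — the bookkeeping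
  device: an energy inequality `J_u^K(a) ≤ J_u^K(b)` transfers to `J_w^K(c) ≤ J_w^K(d)` once the
  integrand of the second difference dominates that of the first a.e. on `K`.
* `imcfEnergy_inf_add_imcfEnergy_sup` — `J_u(min(v,u)) + J_u(max(v,u)) = J_u(v) + J_u(u)`
  (Huisken–Ilmanen, the identity after (1.5)).
* `IsWeakSubsolution.isWeakSolution`, `isWeakSolution_iff_sub_and_super` — a function is a weak
  solution iff it is both a weak sub- and supersolution (Huisken–Ilmanen, after (1.5)).
* `IsWeakSupersolution.add_const`, `IsWeakSubsolution.add_const`, `IsWeakSolution.add_const`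
  (`IsCompetitor.add_const`) — translation invariance `u ↦ u + c` (used as `u + δ`, `v - s` in the
  proof of Thm. 2.2).
* `IsWeakSubsolution.inf_const`, `IsWeakSupersolution.inf_const`, `IsWeakSolution.inf_const`,
  `IsWeakSubsolutionIVP.inf_const` — **(1.18)**: `min(u, t)` is a weak (sub/super)solution if `u`
  is. Huisken–Ilmanen prove this through the set formulation (Lemma 1.1, co-area formula); here
  the competitors `v + (u - min(u,t))` (sub case) and `max(u, min(v, t))` (super case) are inserted
  into (1.5) for `u` directly and the integrands are compared a.e. using the a.e. calculus
  (`|∇u| = 0` a.e. on `{u = t}`, `|∇min(u,t)| = |∇u|` a.e. on `{u ≤ t}`, etc.).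

## References

* G. Huisken, T. Ilmanen, *The inverse mean curvature flow and the Riemannian Penrose
  inequality*, J. Differential Geom. 59 (2001) 353–437: §1 (Definition (1.5) and the remarks
  following it; (1.18)), proof of Thm. 2.2 (ii) (`v_t := min(v, t)`).
-/

noncomputable section

open Bundle Set Manifold TopologicalSpace Filter MeasureTheory Function
open scoped ContDiff Topology ENNReal NNReal Manifold Real

namespace Literature.Geometry.Lorentzian

open PseudoRiemannianMetric

variable {X : Type*} [TopologicalSpace X] [ChartedSpace E3 X] [IsManifold (𝓡 3) ∞ X]

/-! ### Comparing energies through a.e. inequalities of integrands -/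

section Compare

variable {α : Type*} [MeasurableSpace α]

/-- **Transfer of an integral inequality along an a.e. inequality of differences**: if
`F₂ - F₁ ≤ F₄ - F₃` a.e. and `∫ F₁ ≤ ∫ F₂`, then `∫ F₃ ≤ ∫ F₄` (all four integrable). This is the
bookkeeping step of every comparison argument in Huisken–Ilmanen §§1–2 ("inserting `v₁` into
`J_u(u) ≤ J_u(v)` we get …"). [folklore] -/
theorem integral_le_of_integral_le_of_sub_le_sub {μ : Measure α} {F₁ F₂ F₃ F₄ : α → ℝ}
    (h₁ : Integrable F₁ μ) (h₂ : Integrable F₂ μ) (h₃ : Integrable F₃ μ) (h₄ : Integrable F₄ μ)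
    (hle : ∀ᵐ x ∂μ, F₂ x - F₁ x ≤ F₄ x - F₃ x) (h12 : ∫ x, F₁ x ∂μ ≤ ∫ x, F₂ x ∂μ) :
    ∫ x, F₃ x ∂μ ≤ ∫ x, F₄ x ∂μ := by
  have key : ∫ x, F₂ x - F₁ x ∂μ ≤ ∫ x, F₄ x - F₃ x ∂μ :=
    integral_mono_ae (h₂.sub h₁) (h₄.sub h₃) hle
  rw [integral_sub h₂ h₁, integral_sub h₄ h₃] at key
  linarith

end Compare

section Energy

variable (h : ContMDiffRiemannianMetric (𝓡 3) ∞ E3 (TangentSpace (𝓡 3) : X → Type _))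
  [T2Space X] [LocallyCompactSpace X] [MeasurableSpace X] [BorelSpace X]
  [SecondCountableTopology X]

/-- **Energy comparison by a.e. comparison of integrands.** For `u, w` (frozen slopes) and
competitors `a, b, c, d`, all locally Lipschitz on the open set `Ω ⊇ K` (`K` compact): if a.e. on
`K` the integrand of `J_w^K(d) - J_w^K(c)` dominates that of `J_u^K(b) - J_u^K(a)`, then
`J_u^K(a) ≤ J_u^K(b)` implies `J_w^K(c) ≤ J_w^K(d)`. [folklore] -/
theorem imcfEnergy_le_of_ae_sub_le_sub {u w a b c d : X → ℝ} {Ω K : Set X} (hΩ : IsOpen Ω)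
    (hK : IsCompact K) (hKΩ : K ⊆ Ω) (hu : IsLocLipschitzOn h u Ω) (hw : IsLocLipschitzOn h w Ω)
    (ha : IsLocLipschitzOn h a Ω) (hb : IsLocLipschitzOn h b Ω) (hc : IsLocLipschitzOn h c Ω)
    (hd : IsLocLipschitzOn h d Ω)
    (hle : ∀ᵐ x ∂(riemannianMeasure h), x ∈ K →
      (gradNorm h b x + b x * gradNorm h u x) - (gradNorm h a x + a x * gradNorm h u x) ≤
        (gradNorm h d x + d x * gradNorm h w x) - (gradNorm h c x + c x * gradNorm h w x))
    (hab : imcfEnergy h u K a ≤ imcfEnergy h u K b) :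
    imcfEnergy h w K c ≤ imcfEnergy h w K d := by
  unfold imcfEnergy at hab ⊢
  exact integral_le_of_integral_le_of_sub_le_sub
    (integrableOn_imcfEnergy_integrand h hu ha hΩ hK hKΩ)
    (integrableOn_imcfEnergy_integrand h hu hb hΩ hK hKΩ)
    (integrableOn_imcfEnergy_integrand h hw hc hΩ hK hKΩ)
    (integrableOn_imcfEnergy_integrand h hw hd hΩ hK hKΩ)
    ((ae_restrict_iff' hK.measurableSet).2 hle) hab

/-- **`J_u(min(v,u)) + J_u(max(v,u)) = J_u(v) + J_u(u)`** for `u, v` locally Lipschitz on the open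
set `Ω ⊇ K`: the slopes satisfy `|∇max| + |∇min| = |∇v| + |∇u|` a.e.
(`ae_gradNorm_sup_add_gradNorm_inf`) and `max + min = v + u`. Huisken–Ilmanen 2001, §1, the
identity displayed after (1.5). [cite: HuiskenIlmanenIMCF2001, §1 identity after (1.5)] -/
theorem imcfEnergy_inf_add_imcfEnergy_sup {u v : X → ℝ} {Ω K : Set X} (hΩ : IsOpen Ω)
    (hK : IsCompact K) (hKΩ : K ⊆ Ω) (hu : IsLocLipschitzOn h u Ω) (hv : IsLocLipschitzOn h v Ω) :
    imcfEnergy h u K (fun x ↦ min (v x) (u x)) + imcfEnergy h u K (fun x ↦ max (v x) (u x)) =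
      imcfEnergy h u K v + imcfEnergy h u K u := by
  unfold imcfEnergy
  rw [← integral_add (integrableOn_imcfEnergy_integrand h hu (hv.inf h hu) hΩ hK hKΩ)
      (integrableOn_imcfEnergy_integrand h hu (hv.sup h hu) hΩ hK hKΩ),
    ← integral_add (integrableOn_imcfEnergy_integrand h hu hv hΩ hK hKΩ)
      (integrableOn_imcfEnergy_integrand h hu hu hΩ hK hKΩ)]
  refine integral_congr_ae ((ae_restrict_iff' hK.measurableSet).2 ?_)
  filter_upwards [hv.ae_gradNorm_sup_add_gradNorm_inf h hu hΩ] with x hx hxK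
  have h1 := hx (hKΩ hxK)
  have h2 : min (v x) (u x) + max (v x) (u x) = v x + u x := min_add_max _ _
  calc gradNorm h (fun x ↦ min (v x) (u x)) x + min (v x) (u x) * gradNorm h u x +
        (gradNorm h (fun x ↦ max (v x) (u x)) x + max (v x) (u x) * gradNorm h u x)
      = (gradNorm h (fun x ↦ max (v x) (u x)) x + gradNorm h (fun x ↦ min (v x) (u x)) x) +
          (min (v x) (u x) + max (v x) (u x)) * gradNorm h u x := by ring
    _ = (gradNorm h v x + gradNorm h u x) + (v x + u x) * gradNorm h u x := by rw [h1, h2]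
    _ = gradNorm h v x + v x * gradNorm h u x + (gradNorm h u x + u x * gradNorm h u x) := by ring

end Energy

/-! ### Weak solutions are exactly the simultaneous sub- and supersolutions -/

section SubSuper

variable (h : ContMDiffRiemannianMetric (𝓡 3) ∞ E3 (TangentSpace (𝓡 3) : X → Type _))
  [T2Space X] [LocallyCompactSpace X] [MeasurableSpace X] [BorelSpace X]
  [SecondCountableTopology X]

/-- **Sub- and supersolution ⟹ solution.** If `u` is simultaneously a weak subsolution and a weak
supersolution of (∗∗) on the open set `Ω`, it is a weak solution: for a competitor `v`, both
`min(v, u) ≤ u` and `max(v, u) ≥ u` are competitors, and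
`J_u(min(v,u)) + J_u(max(v,u)) = J_u(v) + J_u(u)`, so `2 J_u(u) ≤ J_u(v) + J_u(u)`. Huisken–Ilmanen
2001, §1, after (1.5) ("`u` is a weak solution if and only if `u` is simultaneously a weak
supersolution and a weak subsolution"). [cite: HuiskenIlmanenIMCF2001, §1 after (1.5)] -/
theorem IsWeakSubsolution.isWeakSolution {u : X → ℝ} {Ω : Set X} (hsub : IsWeakSubsolution h u Ω)
    (hsup : IsWeakSupersolution h u Ω) (hΩ : IsOpen Ω) : IsWeakSolution h u Ω := by
  refine ⟨hsub.1, fun v hv K hK hKΩ hvK ↦ ?_⟩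
  obtain ⟨hvlip, C, hC, hCΩ, hvC⟩ := hv
  have hu := hsub.1
  -- the two one-sided competitors
  have hmin : IsCompetitor h u Ω (fun x ↦ min (v x) (u x)) := by
    refine ⟨hvlip.inf h hu, C, hC, hCΩ, fun x hx ↦ hvC ⟨hx.1, fun hvu ↦ hx.2 ?_⟩⟩
    simp [hvu]
  have hmax : IsCompetitor h u Ω (fun x ↦ max (v x) (u x)) := by
    refine ⟨hvlip.sup h hu, C, hC, hCΩ, fun x hx ↦ hvC ⟨hx.1, fun hvu ↦ hx.2 ?_⟩⟩
    simp [hvu]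
  have hminK : {x | x ∈ Ω ∧ min (v x) (u x) ≠ u x} ⊆ K :=
    fun x hx ↦ hvK ⟨hx.1, fun hvu ↦ hx.2 (by simp [hvu])⟩
  have hmaxK : {x | x ∈ Ω ∧ max (v x) (u x) ≠ u x} ⊆ K :=
    fun x hx ↦ hvK ⟨hx.1, fun hvu ↦ hx.2 (by simp [hvu])⟩
  have h1 := hsub.2 _ hmin (fun x _ ↦ min_le_right _ _) K hK hKΩ hminK
  have h2 := hsup.2 _ hmax (fun x _ ↦ le_max_right _ _) K hK hKΩ hmaxK
  have h3 := imcfEnergy_inf_add_imcfEnergy_sup h hΩ hK hKΩ hu hvlip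
  linarith

/-- A function is a weak solution on an open set iff it is both a weak subsolution and a weak
supersolution there. Huisken–Ilmanen 2001, §1, after (1.5). [cite: HuiskenIlmanenIMCF2001, §1 after (1.5)] -/
theorem isWeakSolution_iff_sub_and_super {u : X → ℝ} {Ω : Set X} (hΩ : IsOpen Ω) :
    IsWeakSolution h u Ω ↔ IsWeakSubsolution h u Ω ∧ IsWeakSupersolution h u Ω :=
  ⟨fun hu ↦ ⟨hu.isWeakSubsolution h, hu.isWeakSupersolution h⟩,
    fun hu ↦ hu.1.isWeakSolution h hu.2 hΩ⟩

end SubSuper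

/-! ### Translation invariance: `u ↦ u + c` -/

section Translate

variable (h : ContMDiffRiemannianMetric (𝓡 3) ∞ E3 (TangentSpace (𝓡 3) : X → Type _))
  [T2Space X] [LocallyCompactSpace X] [MeasurableSpace X] [BorelSpace X]
  [SecondCountableTopology X]

omit [MeasurableSpace X] [BorelSpace X] [SecondCountableTopology X] in
/-- Translating a competitor together with `u` keeps it a competitor, with the same exceptional
set. [folklore] -/
theorem IsCompetitor.add_const {u v : X → ℝ} {Ω : Set X} (hv : IsCompetitor h u Ω v) (c : ℝ) :
    IsCompetitor h (fun x ↦ u x + c) Ω (fun x ↦ v x + c) := by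
  obtain ⟨hvlip, C, hC, hCΩ, hvC⟩ := hv
  exact ⟨hvlip.add_const h c, C, hC, hCΩ, fun x hx ↦ hvC ⟨hx.1, fun hvu ↦ hx.2 (by
    show v x + c = u x + c
    rw [hvu])⟩⟩

/-- **Translation invariance, supersolutions**: if `u` is a weak supersolution of (∗∗) on the open
set `Ω` then so is `u + c` (`|∇(u + c)| = |∇u|`, and `J_{u+c}(w) - J_{u+c}(u+c) = J_u(w - c) - J_u(u)`).
Used by Huisken–Ilmanen as "`u + δ`" in the proof of Thm. 2.2 (ii) and "by subtracting a constant"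
in the proof of Thm. 2.2 (i). [cite: HuiskenIlmanenIMCF2001, proof of Thm. 2.2] -/
theorem IsWeakSupersolution.add_const {u : X → ℝ} {Ω : Set X} (hu : IsWeakSupersolution h u Ω)
    (hΩ : IsOpen Ω) (c : ℝ) : IsWeakSupersolution h (fun x ↦ u x + c) Ω := by
  refine ⟨hu.1.add_const h c, fun w hw hle K hK hKΩ hwK ↦ ?_⟩
  have hw' : IsCompetitor h u Ω (fun x ↦ w x - c) := by
    have := hw.add_const h (-c)
    simp only [add_neg_cancel_right] at this
    simpa only [sub_eq_add_neg] using this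
  have hle' : ∀ x ∈ Ω, u x ≤ w x - c := fun x hx ↦ by have := hle x hx; linarith
  have hwK' : {x | x ∈ Ω ∧ w x - c ≠ u x} ⊆ K :=
    fun x hx ↦ hwK ⟨hx.1, fun hwu ↦ hx.2 (by rw [hwu]; ring)⟩
  have key := hu.2 _ hw' hle' K hK hKΩ hwK'
  refine imcfEnergy_le_of_ae_sub_le_sub h hΩ hK hKΩ hu.1 (hu.1.add_const h c) hu.1 hw'.1
    (hu.1.add_const h c) hw.1 (Eventually.of_forall fun x _ ↦ ?_) key
  rw [gradNorm_sub_const, gradNorm_add_const]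
  exact le_of_eq (by ring)

/-- **Translation invariance, subsolutions**: if `u` is a weak subsolution on the open set `Ω` then
so is `u + c`. [cite: HuiskenIlmanenIMCF2001, proof of Thm. 2.2] -/
theorem IsWeakSubsolution.add_const {u : X → ℝ} {Ω : Set X} (hu : IsWeakSubsolution h u Ω)
    (hΩ : IsOpen Ω) (c : ℝ) : IsWeakSubsolution h (fun x ↦ u x + c) Ω := by
  refine ⟨hu.1.add_const h c, fun w hw hle K hK hKΩ hwK ↦ ?_⟩
  have hw' : IsCompetitor h u Ω (fun x ↦ w x - c) := by
    have := hw.add_const h (-c)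
    simp only [add_neg_cancel_right] at this
    simpa only [sub_eq_add_neg] using this
  have hle' : ∀ x ∈ Ω, w x - c ≤ u x := fun x hx ↦ by have := hle x hx; linarith
  have hwK' : {x | x ∈ Ω ∧ w x - c ≠ u x} ⊆ K :=
    fun x hx ↦ hwK ⟨hx.1, fun hwu ↦ hx.2 (by rw [hwu]; ring)⟩
  have key := hu.2 _ hw' hle' K hK hKΩ hwK'
  refine imcfEnergy_le_of_ae_sub_le_sub h hΩ hK hKΩ hu.1 (hu.1.add_const h c) hu.1 hw'.1
    (hu.1.add_const h c) hw.1 (Eventually.of_forall fun x _ ↦ ?_) key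
  rw [gradNorm_sub_const, gradNorm_add_const]
  exact le_of_eq (by ring)

/-- **Translation invariance, solutions**: if `u` is a weak solution on the open set `Ω` then so is
`u + c`. [cite: HuiskenIlmanenIMCF2001, proof of Thm. 2.2] -/
theorem IsWeakSolution.add_const {u : X → ℝ} {Ω : Set X} (hu : IsWeakSolution h u Ω)
    (hΩ : IsOpen Ω) (c : ℝ) : IsWeakSolution h (fun x ↦ u x + c) Ω :=
  ((hu.isWeakSubsolution h).add_const h hΩ c).isWeakSolution h
    ((hu.isWeakSupersolution h).add_const h hΩ c) hΩ

end Translate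

/-! ### (1.18): truncation from above, `u ↦ min(u, t)` -/

section Truncate

variable (h : ContMDiffRiemannianMetric (𝓡 3) ∞ E3 (TangentSpace (𝓡 3) : X → Type _))
  [T2Space X] [LocallyCompactSpace X] [MeasurableSpace X] [BorelSpace X]
  [SecondCountableTopology X]

/-- **(1.18), subsolutions: `min(u, t)` is a weak subsolution if `u` is.** Given a competitor
`v ≤ w := min(u, t)`, the function `vv = v + (u - w)` is a competitor `≤ u` for `u` with the same
exceptional set, and a.e. on `K` the integrand of `J_w(v) - J_w(w)` dominates that of
`J_u(vv) - J_u(u)`: on `{u < t}` they agree (`w = u`, `vv = v` nearby), on `{u > t}` one uses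
`|∇w| = 0`, `|∇vv| ≤ |∇v| + |∇u|` and `v ≤ t`, and on `{u = t}` that `|∇u| = 0` a.e. This is the
functional counterpart of Huisken–Ilmanen's set-theoretic proof ("the left hand side only
increases"). Huisken–Ilmanen 2001, §1, (1.18). [cite: HuiskenIlmanenIMCF2001, §1 (1.18)] -/
theorem IsWeakSubsolution.inf_const {u : X → ℝ} {Ω : Set X} (hu : IsWeakSubsolution h u Ω)
    (hΩ : IsOpen Ω) (t : ℝ) : IsWeakSubsolution h (fun x ↦ min (u x) t) Ω := by
  have hul := hu.1
  have hwl : IsLocLipschitzOn h (fun x ↦ min (u x) t) Ω := hul.inf h (isLocLipschitzOn_const h t Ω)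
  refine ⟨hwl, fun v hv hle K hK hKΩ hvK ↦ ?_⟩
  obtain ⟨hvl, C, hC, hCΩ, hvC⟩ := hv
  -- the competitor `vv = v + (u - min(u, t))` for `u`
  set vv : X → ℝ := fun x ↦ v x + (u x - min (u x) t) with hvv
  have hvvl : IsLocLipschitzOn h vv Ω := hvl.add h (hul.sub h hwl)
  have hne : ∀ x, vv x ≠ u x → v x ≠ min (u x) t := by
    intro x h1 h2
    apply h1
    simp only [hvv, h2]
    ring
  have hvvc : IsCompetitor h u Ω vv := ⟨hvvl, C, hC, hCΩ, fun x hx ↦ hvC ⟨hx.1, hne x hx.2⟩⟩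
  have hvvle : ∀ x ∈ Ω, vv x ≤ u x := fun x hx ↦ by
    have := hle x hx
    simp only [hvv]
    linarith
  have hvvK : {x | x ∈ Ω ∧ vv x ≠ u x} ⊆ K := fun x hx ↦ hvK ⟨hx.1, hne x hx.2⟩
  have key := hu.2 vv hvvc hvvle K hK hKΩ hvvK
  refine imcfEnergy_le_of_ae_sub_le_sub h hΩ hK hKΩ hul hwl hul hvvl hwl hvl ?_ key
  filter_upwards [hul.ae_gradNorm_eq_zero_of_eq_const h hΩ t, hwl.ae_gradNorm_eq_of_eq h hul hΩ,
    hvvl.ae_gradNorm_eq_of_eq h hvl hΩ, hvl.ae_mdifferentiableAt h hΩ, hul.ae_mdifferentiableAt h hΩ]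
    with x h1 h2 h3 h4 h5 hxK
  have hxΩ := hKΩ hxK
  have huc : ContinuousAt u x := (hul.continuousOn h).continuousAt (hΩ.mem_nhds hxΩ)
  have hvx : v x ≤ min (u x) t := hle x hxΩ
  have hg0 := gradNorm_nonneg h u x
  rcases lt_trichotomy (u x) t with hlt | heq | hgt
  · -- `u < t` near `x`: `w = u` and `vv = v` near `x`
    have hev : ∀ᶠ y in 𝓝 x, u y < t := huc.eventually_lt continuousAt_const hlt
    have hw : gradNorm h (fun y ↦ min (u y) t) x = gradNorm h u x :=
      gradNorm_congr_of_eventuallyEq h (hev.mono fun y hy ↦ min_eq_left hy.le)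
    have hvvv : gradNorm h vv x = gradNorm h v x :=
      gradNorm_congr_of_eventuallyEq h (hev.mono fun y hy ↦ by
        simp only [hvv, min_eq_left hy.le, sub_self, add_zero])
    have hmin : min (u x) t = u x := min_eq_left hlt.le
    have hvvx : vv x = v x := by simp only [hvv, hmin, sub_self, add_zero]
    rw [hw, hvvv, hmin, hvvx]
  · -- `u x = t`: `|∇u| = |∇w| = 0` and `|∇vv| = |∇v|` at `x` (a.e.)
    have hgu : gradNorm h u x = 0 := h1 hxΩ heq
    have hmin : min (u x) t = u x := by rw [heq, min_self]
    have hgw : gradNorm h (fun y ↦ min (u y) t) x = 0 := (h2 hxΩ hmin).trans hgu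
    have hvvx : vv x = v x := by simp only [hvv, hmin, sub_self, add_zero]
    have hgvv : gradNorm h vv x = gradNorm h v x := h3 hxΩ hvvx
    rw [hgu, hgw, hgvv, hvvx, hmin]
  · -- `u > t` near `x`: `w = t` and `vv = v + (u - t)` near `x`
    have hev : ∀ᶠ y in 𝓝 x, t < u y := continuousAt_const.eventually_lt huc hgt
    have hw : gradNorm h (fun y ↦ min (u y) t) x = 0 :=
      (gradNorm_congr_of_eventuallyEq h (hev.mono fun y hy ↦ min_eq_right hy.le)).trans
        (gradNorm_const h t x)
    have hvv' : gradNorm h vv x = gradNorm h (fun y ↦ v y + (u y - t)) x :=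
      gradNorm_congr_of_eventuallyEq h (hev.mono fun y hy ↦ by simp only [hvv, min_eq_right hy.le])
    have htri : gradNorm h (fun y ↦ v y + (u y - t)) x ≤ gradNorm h v x + gradNorm h u x := by
      have hd : MDifferentiableAt (𝓡 3) 𝓘(ℝ, ℝ) (fun y ↦ u y - t) x :=
        (h5 hxΩ).sub mdifferentiableAt_const
      calc gradNorm h (fun y ↦ v y + (u y - t)) x
          ≤ gradNorm h v x + gradNorm h (fun y ↦ u y - t) x := gradNorm_add_le h (h4 hxΩ) hd
        _ = gradNorm h v x + gradNorm h u x := by rw [gradNorm_sub_const]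
    have hmin : min (u x) t = t := min_eq_right hgt.le
    have hvvx : vv x = v x + (u x - t) := by simp only [hvv, hmin]
    rw [hmin] at hvx
    have hprod : v x * gradNorm h u x ≤ t * gradNorm h u x := mul_le_mul_of_nonneg_right hvx hg0
    rw [hw, hvv', hvvx, hmin]
    nlinarith [htri, hprod, hg0, gradNorm_nonneg h v x]

/-- **(1.18), supersolutions: `min(u, t)` is a weak supersolution if `u` is.** A competitor
`v ≥ w := min(u, t)` is first truncated to `v₁ = min(v, t)` (still a competitor `≥ w`, with
`J_w(v₁) ≤ J_w(v)` since `|∇v₁| ≤ |∇v|` a.e. and `|∇w| ≥ 0`); then `vv = max(u, v₁) ≥ u` is a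
competitor for `u` with the same exceptional set, and a.e. on `K` the integrand of
`J_w(v₁) - J_w(w)` dominates that of `J_u(vv) - J_u(u)` (on `{u > t}` both `w` and `v₁` equal `t`
nearby). Huisken–Ilmanen 2001, §1, (1.18). [cite: HuiskenIlmanenIMCF2001, §1 (1.18)] -/
theorem IsWeakSupersolution.inf_const {u : X → ℝ} {Ω : Set X} (hu : IsWeakSupersolution h u Ω)
    (hΩ : IsOpen Ω) (t : ℝ) : IsWeakSupersolution h (fun x ↦ min (u x) t) Ω := by
  have hul := hu.1
  have hwl : IsLocLipschitzOn h (fun x ↦ min (u x) t) Ω := hul.inf h (isLocLipschitzOn_const h t Ω)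
  refine ⟨hwl, fun v hv hle K hK hKΩ hvK ↦ ?_⟩
  obtain ⟨hvl, C, hC, hCΩ, hvC⟩ := hv
  -- Step 1: truncate the competitor at height `t`
  set v₁ : X → ℝ := fun x ↦ min (v x) t with hv₁
  have hv₁l : IsLocLipschitzOn h v₁ Ω := hvl.inf h (isLocLipschitzOn_const h t Ω)
  have hv₁w : ∀ x ∈ Ω, min (u x) t ≤ v₁ x := fun x hx ↦ le_min (hle x hx) (min_le_right _ _)
  have hv₁t : ∀ x, v₁ x ≤ t := fun x ↦ min_le_right _ _
  have hne₁ : ∀ x, v₁ x ≠ min (u x) t → v x ≠ min (u x) t := by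
    intro x h1 h2
    apply h1
    simp only [hv₁, h2, min_assoc, min_self]
  have hstep : imcfEnergy h (fun x ↦ min (u x) t) K v₁ ≤ imcfEnergy h (fun x ↦ min (u x) t) K v := by
    unfold imcfEnergy
    refine integral_mono_ae (integrableOn_imcfEnergy_integrand h hwl hv₁l hΩ hK hKΩ)
      (integrableOn_imcfEnergy_integrand h hwl hvl hΩ hK hKΩ) ?_
    refine (ae_restrict_iff' hK.measurableSet).2 ?_
    filter_upwards [hv₁l.ae_gradNorm_eq_of_eq h hvl hΩ] with x h1 hxK
    have hxΩ := hKΩ hxK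
    have hvc : ContinuousAt v x := (hvl.continuousOn h).continuousAt (hΩ.mem_nhds hxΩ)
    have hg1 : gradNorm h v₁ x ≤ gradNorm h v x := by
      rcases lt_trichotomy (v x) t with hlt | heq | hgt
      · exact (gradNorm_inf_of_lt h hvc continuousAt_const hlt).le
      · exact (h1 hxΩ (by simp only [hv₁, heq, min_self])).le
      · rw [gradNorm_inf_of_gt h hvc continuousAt_const hgt, gradNorm_const]
        exact gradNorm_nonneg h v x
    have hg2 : v₁ x * gradNorm h (fun x ↦ min (u x) t) x ≤ v x * gradNorm h (fun x ↦ min (u x) t) x :=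
      mul_le_mul_of_nonneg_right (min_le_left _ _) (gradNorm_nonneg h _ x)
    linarith
  refine le_trans ?_ hstep
  -- Step 2: the competitor `vv = max(u, v₁)` for `u`
  set vv : X → ℝ := fun x ↦ max (u x) (v₁ x) with hvv
  have hvvl : IsLocLipschitzOn h vv Ω := hul.sup h hv₁l
  have hne : ∀ x, vv x ≠ u x → v₁ x ≠ min (u x) t := by
    intro x h1 h2
    apply h1
    simp only [hvv, h2]
    exact max_eq_left (min_le_left _ _)
  have hvvc : IsCompetitor h u Ω vv :=
    ⟨hvvl, C, hC, hCΩ, fun x hx ↦ hvC ⟨hx.1, hne₁ x (hne x hx.2)⟩⟩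
  have hvvge : ∀ x ∈ Ω, u x ≤ vv x := fun x _ ↦ le_max_left _ _
  have hvvK : {x | x ∈ Ω ∧ vv x ≠ u x} ⊆ K := fun x hx ↦ hvK ⟨hx.1, hne₁ x (hne x hx.2)⟩
  have key := hu.2 vv hvvc hvvge K hK hKΩ hvvK
  refine imcfEnergy_le_of_ae_sub_le_sub h hΩ hK hKΩ hul hwl hul hvvl hwl hv₁l ?_ key
  filter_upwards [hul.ae_gradNorm_eq_zero_of_eq_const h hΩ t, hwl.ae_gradNorm_eq_of_eq h hul hΩ,
    hvvl.ae_gradNorm_eq_of_eq h hul hΩ, hv₁l.ae_gradNorm_eq_of_eq h hul hΩ]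
    with x h1 h2 h3 h5 hxK
  have hxΩ := hKΩ hxK
  have huc : ContinuousAt u x := (hul.continuousOn h).continuousAt (hΩ.mem_nhds hxΩ)
  have hv₁c : ContinuousAt v₁ x := (hv₁l.continuousOn h).continuousAt (hΩ.mem_nhds hxΩ)
  have hwv : min (u x) t ≤ v₁ x := hv₁w x hxΩ
  rcases lt_trichotomy (u x) t with hlt | heq | hgt
  · -- `u < t` near `x`: `w = u` near `x`
    have hev : ∀ᶠ y in 𝓝 x, u y < t := huc.eventually_lt continuousAt_const hlt
    have hgw : gradNorm h (fun y ↦ min (u y) t) x = gradNorm h u x :=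
      gradNorm_congr_of_eventuallyEq h (hev.mono fun y hy ↦ min_eq_left hy.le)
    have hwx : min (u x) t = u x := min_eq_left hlt.le
    rw [hwx] at hwv
    rcases hwv.lt_or_eq with hlt' | heq'
    · -- `u x < v₁ x`: `vv = v₁` near `x`
      have hgvv : gradNorm h vv x = gradNorm h v₁ x := gradNorm_sup_of_lt h huc hv₁c hlt'
      have hvvx : vv x = v₁ x := max_eq_right hlt'.le
      rw [hgvv, hvvx, hgw, hwx]
    · -- `u x = v₁ x`
      have hvvx : vv x = u x := by simp only [hvv, ← heq', max_self]
      have hgvv : gradNorm h vv x = gradNorm h u x := h3 hxΩ hvvx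
      have hgv : gradNorm h v₁ x = gradNorm h u x := h5 hxΩ heq'.symm
      rw [hgvv, hvvx, hgw, hwx, hgv, ← heq']
  · -- `u x = t`
    have hgu : gradNorm h u x = 0 := h1 hxΩ heq
    have hwx : min (u x) t = u x := by rw [heq, min_self]
    have hgw : gradNorm h (fun y ↦ min (u y) t) x = 0 := (h2 hxΩ hwx).trans hgu
    have hv₁x : v₁ x = u x := le_antisymm (heq ▸ hv₁t x) (hwx ▸ hwv)
    have hvvx : vv x = u x := by simp only [hvv, hv₁x, max_self]
    have hgvv : gradNorm h vv x = 0 := (h3 hxΩ hvvx).trans hgu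
    have hgv : gradNorm h v₁ x = 0 := (h5 hxΩ hv₁x).trans hgu
    rw [hgu, hgw, hgvv, hgv]
    simp
  · -- `u > t` near `x`: `w = v₁ = t` and `vv = u` near `x`
    have hev : ∀ᶠ y in 𝓝 x, t < u y := continuousAt_const.eventually_lt huc hgt
    have hevΩ : ∀ᶠ y in 𝓝 x, y ∈ Ω := hΩ.mem_nhds hxΩ
    have hgw : gradNorm h (fun y ↦ min (u y) t) x = 0 :=
      (gradNorm_congr_of_eventuallyEq h (hev.mono fun y hy ↦ min_eq_right hy.le)).trans
        (gradNorm_const h t x)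
    have hv₁ev : ∀ᶠ y in 𝓝 x, v₁ y = t := by
      filter_upwards [hev, hevΩ] with y hy hyΩ
      refine le_antisymm (hv₁t y) ?_
      have := hv₁w y hyΩ
      rwa [min_eq_right hy.le] at this
    have hgv : gradNorm h v₁ x = 0 :=
      (gradNorm_congr_of_eventuallyEq h hv₁ev).trans (gradNorm_const h t x)
    have hvvev : vv =ᶠ[𝓝 x] u := by
      filter_upwards [hev, hv₁ev] with y hy hy1
      simp only [hvv, hy1]
      exact max_eq_left hy.le
    have hgvv : gradNorm h vv x = gradNorm h u x := gradNorm_congr_of_eventuallyEq h hvvev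
    have hvvx : vv x = u x := hvvev.self_of_nhds
    rw [hgw, hgv, hgvv, hvvx]
    simp

/-- **(1.18): `min(u, t)` is a weak solution if `u` is** ("the surfaces would like to jump
instantly to infinity in order to exploit the negative bulk energy term"). Huisken–Ilmanen 2001,
§1, (1.18); used in the proof of Thm. 2.2 (ii) ("`v_t := min(v, t)` solves (1.5) on `M ∖ F̄₀`")
and of Thm. 3.1, step 2. [cite: HuiskenIlmanenIMCF2001, §1 (1.18)] -/
theorem IsWeakSolution.inf_const {u : X → ℝ} {Ω : Set X} (hu : IsWeakSolution h u Ω)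
    (hΩ : IsOpen Ω) (t : ℝ) : IsWeakSolution h (fun x ↦ min (u x) t) Ω :=
  ((hu.isWeakSubsolution h).inf_const h hΩ t).isWeakSolution h
    ((hu.isWeakSupersolution h).inf_const h hΩ t) hΩ

/-- (1.18) for the initial value problem: if `v` is a weak subsolution with initial condition `F₀`
(Huisken–Ilmanen's (††)), then `min(v, t)` is a weak subsolution of (∗∗) on `M ∖ F̄₀`.
[cite: HuiskenIlmanenIMCF2001, §1 (1.18) and proof of Thm. 2.2 (ii)] -/
theorem IsWeakSubsolutionIVP.inf_const {v : X → ℝ} {F₀ : Set X} (hv : IsWeakSubsolutionIVP h v F₀)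
    (t : ℝ) : IsWeakSubsolution h (fun x ↦ min (v x) t) (closure F₀)ᶜ :=
  hv.2.2.inf_const h isClosed_closure.isOpen_compl t

end Truncate

end Literature.Geometry.Lorentzian

end
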